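import Summits.Ventures.CertifiedManyBodySolver.Rows.HalfFilledTLTorusPinObs
import Summits.Ventures.CertifiedManyBodySolver.Observables.StructureFactorsPositivity
import Summits.Ventures.CertifiedManyBodySolver.Observables.SpinCorrelatorRange

/-!
# M2 rows, part 9 (v1.1): the observable-range nodes of the spin enclosure rows are tree theorems

HONEST FRAMING (speedrun cell `mbsolver`, M2): first certified bounds; not a superconductivity
verdict; every number certified or labelled float.  This file contains NO numbers.  Part 8
(`HalfFilledTLTorusPinObs`) reads the table's Kato–Temple ENCLOSURE records for the correlators of THE
half-filled `L × L` torus ground state as edges `claim nodes → row`, one claim node being the observable's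
RANGE `(m, h)`: `‖⟨x, Ox⟩ − m⟨x, x⟩‖ ≤ h·Re⟨x, x⟩` for all Fock vectors `x` (part 8 §4 discharged it for
the double occupancy `D`).  Here the node is discharged for the two STAGGERED spin observables,
`𝓢_A = Σ_{x,y} ε_x ε_y 𝐒_x·𝐒_y` (`stagSpinStructure (evenSublattice L)`, the `m_s²` row) and
`𝓢_s(π,π)` (`Observables.spinStructureOp L (piIndex L)`, the `S(π,π)` row; equal to `𝓢_A` on an even
torus, `spinStructureOp_piIndex`), from three tree facts:

* `0 ≤ 𝓢_s(k)` as a form for every momentum (`Observables.spinStructureFactor_nonneg`: `𝓢_s(k)` is a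
  sum of `A Aᴴ`);
* Tasaki's moment-depletion ceiling `𝓢_A ≤ ((k+2)/2) Σ_x m_x` for `|A|, |Aᶜ| ≤ k`
  (`FermionSpinMoment.posSemidef_stagCeiling_sub`), used with the crude `k = |Λ|`;
* `Σ_x m_x ≤ |Λ|` as forms — each local moment `m_x` is an orthogonal projection
  (`posSemidef_one_sub_localMoment`, `posSemidef_card_sub_sum_localMoment`, this file).

Hence `0 ≤ Re⟨x, 𝓢_A x⟩ ≤ ((L²+2)L²/2)·Re⟨x, x⟩` on the torus of side `L`, i.e. the range node holds with
`(m, h) = ((L²+2)L²/4, (L²+2)L²/4)` (`stagSpinStructure_formBound`, `spinStructureOp_piIndex_formBound`),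
and the `S(π,π)` / `m_s²` edges of part 8 need no `hOform` hypothesis
(`TorusStagSFRow.of_blockPin_templeKato_range`, `StagMagSqRow.of_blockPin_templeKato_range`; mixing
radius `((L²+2)L²/2)(β + β²)`).

§4 (v1.1) discharges the node for the real-space correlator `W_r = Σ_x 𝐒_x·𝐒_{x+r}`, `r ≠ 0` (the `C₁`
row is `r = e₁`): m3-7's `Observables/SpinCorrelatorRange` proves the operator sandwich
`−¾ Σ_x m_x ≤ W_r ≤ ¼ Σ_x m_x` (two-site triplet/singlet bounds summed over the torus); with
`0 ≤ Σ_x m_x ≤ L²` (§1) this is `−¾L²·Re⟨x,x⟩ ≤ Re⟨x, W_r x⟩ ≤ ¼L²·Re⟨x,x⟩`, i.e. the range node with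
`(m, h) = (−L²/4, L²/2)` (`spinCorrSum_formBound`; `L = 4`: `(−4, 8)`), and the `C₁` edge of part 8 needs
no `hOform` hypothesis (`TorusSpinNNRow.of_blockPin_templeKato_range`; mixing radius `L²(β + β²)`).
References: Tasaki (2020) App. A.3; Lieb, PRL 62 (1989) 1201, Thm 2; Saad (1992) Ch. III §3.2
Thm 3.8–3.9; Hirsch, PRB 31 (1985) 4403, eq. (4.7); Essler et al. (2005) §2.2.5 (two-site spin algebra).
-/

noncomputable section

namespace Summit.Ventures.CertifiedManyBodySolver
open Literature.MathematicalPhysics.QuantumLattice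
open Matrix HubbardWave0 Literature.Probability.LatticeModels EigenvalueContinuation FermionSpinMoment
open scoped ComplexOrder

namespace M2

/-! ## §1 `Σ_x m_x ≤ |Λ|` and the form range of `𝓢_A` on a general finite lattice -/

section Generic

variable {Λ : Type*} [LinearOrder Λ] [Fintype Λ]

/-- `1 − m_x ⪰ 0`: the local moment `m_x` is an orthogonal projection (`m_xᴴ = m_x = m_x²`).
[cite: EsslerEtAl2005, §2.2.5 eq. (2.76)] -/
theorem posSemidef_one_sub_localMoment (x : Λ) :
    (1 - localMoment x : Matrix (Finset (Orb Λ)) (Finset (Orb Λ)) ℂ).PosSemidef := by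
  have hsq : (1 - localMoment x : Matrix (Finset (Orb Λ)) (Finset (Orb Λ)) ℂ)ᴴ * (1 - localMoment x) =
      1 - localMoment x := by
    rw [conjTranspose_sub, conjTranspose_one, (isHermitian_localMoment x).eq, sub_mul, one_mul, mul_sub,
      mul_one, localMoment_mul_self, sub_self, sub_zero]
  rw [← hsq]
  exact posSemidef_conjTranspose_mul_self _

/-- `|Λ|·1 − Σ_x m_x ⪰ 0` (at most one singly occupied orbital pair per site).
[cite: EsslerEtAl2005, §2.2.5 eq. (2.76)] -/
theorem posSemidef_card_sub_sum_localMoment :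
    (((Fintype.card Λ : ℕ) : ℂ) • (1 : Matrix (Finset (Orb Λ)) (Finset (Orb Λ)) ℂ) -
      ∑ x : Λ, localMoment x).PosSemidef := by
  have h : ((Fintype.card Λ : ℕ) : ℂ) • (1 : Matrix (Finset (Orb Λ)) (Finset (Orb Λ)) ℂ) -
      ∑ x : Λ, localMoment x = ∑ x : Λ, (1 - localMoment x) := by
    rw [Finset.sum_sub_distrib, Finset.sum_const, Finset.card_univ, ← Nat.cast_smul_eq_nsmul ℂ]
  rw [h]
  exact posSemidef_finset_sum _ fun x _ => posSemidef_one_sub_localMoment x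

/-- `Re⟨x, (Σ_y m_y) x⟩ ≤ |Λ|·Re⟨x, x⟩` for every Fock vector `x`. [cite: EsslerEtAl2005, §2.2.5] -/
theorem re_expect_sum_localMoment_le (x : Fock (Orb Λ)) :
    (star x ⬝ᵥ (∑ y : Λ, localMoment y) *ᵥ x).re ≤ (Fintype.card Λ : ℝ) * (star x ⬝ᵥ x).re := by
  have h := (posSemidef_card_sub_sum_localMoment (Λ := Λ)).dotProduct_mulVec_nonneg x
  rw [sub_mulVec, Matrix.smul_mulVec, one_mulVec, dotProduct_sub, dotProduct_smul] at h
  have h' := (Complex.nonneg_iff.1 h).1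
  rw [Complex.sub_re, smul_eq_mul, ← Complex.ofReal_natCast, Complex.re_ofReal_mul] at h'
  linarith

omit [Fintype Λ] in
/-- `0 ≤ ((|Λ'|+2)/2 : ℂ)` for a natural number `|Λ'|` (star order of `ℂ`). [folklore] -/
theorem ceilCoeff_nonneg (k : ℕ) : (0 : ℂ) ≤ ((k : ℂ) + 2) / 2 := by
  rw [show ((k : ℂ) + 2) / 2 = ((((k : ℝ) + 2) / 2 : ℝ) : ℂ) by push_cast; ring]
  exact Complex.zero_le_real.2 (by positivity)

/-- `𝓢_A` is Hermitian (difference of two positive operators in Tasaki's ceiling).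
[cite: Tasaki2020, App. A.3] -/
theorem isHermitian_stagSpinStructure (A : Finset Λ) : (stagSpinStructure A).IsHermitian := by
  have h1 := (posSemidef_stagCeiling_sub A (Finset.card_le_univ A) (Finset.card_le_univ Aᶜ)).1
  have h2 := ((posSemidef_sum_localMoment (Finset.univ : Finset Λ)).smul
    (ceilCoeff_nonneg (Fintype.card Λ))).1
  have h := h2.sub h1
  rwa [sub_sub_cancel] at h

/-- **Form ceiling of `𝓢_A`**: `Re⟨x, 𝓢_A x⟩ ≤ ((|Λ|+2)/2)·|Λ|·Re⟨x, x⟩` for every Fock vector `x`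
(Tasaki's ceiling with `k = |Λ|`, then `Σ_x m_x ≤ |Λ|`). [cite: Tasaki2020, App. A.3] -/
theorem re_expect_stagSpinStructure_le_card (A : Finset Λ) (x : Fock (Orb Λ)) :
    (star x ⬝ᵥ stagSpinStructure A *ᵥ x).re ≤
      ((Fintype.card Λ : ℝ) + 2) / 2 * (Fintype.card Λ : ℝ) * (star x ⬝ᵥ x).re := by
  have h := (posSemidef_stagCeiling_sub A (Finset.card_le_univ A)
    (Finset.card_le_univ Aᶜ)).dotProduct_mulVec_nonneg x
  rw [sub_mulVec, smul_mulVec, dotProduct_sub, dotProduct_smul] at h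
  have hc : (((Fintype.card Λ : ℂ) + 2) / 2) = ((((Fintype.card Λ : ℝ) + 2) / 2 : ℝ) : ℂ) := by
    push_cast; ring
  rw [hc] at h
  obtain ⟨hre, -⟩ := Complex.nonneg_iff.mp h
  rw [Complex.sub_re, smul_eq_mul, Complex.re_ofReal_mul] at hre
  have hm := re_expect_sum_localMoment_le x
  have hpos : 0 ≤ ((Fintype.card Λ : ℝ) + 2) / 2 := by positivity
  nlinarith [mul_le_mul_of_nonneg_left hm hpos]

/-- `⟨x, 𝓢_A x⟩` is real. [cite: Tasaki2020, App. A.3] -/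
theorem im_expect_stagSpinStructure (A : Finset Λ) (x : Fock (Orb Λ)) :
    (star x ⬝ᵥ stagSpinStructure A *ᵥ x).im = 0 := by
  have h := star_dotProduct_mulVec_comm (isHermitian_stagSpinStructure A) x x
  exact Complex.conj_eq_iff_im.1 (by rw [← Complex.star_def]; exact h.symm)

/-- two-sided variant of `formBound_of_re_mem`: `a·Re⟨x,x⟩ ≤ Re⟨x, Ox⟩ ≤ b·Re⟨x,x⟩` with `⟨x, Ox⟩`
real gives `‖⟨x, Ox⟩ − ((a+b)/2)⟨x, x⟩‖ ≤ ((b−a)/2)·Re⟨x, x⟩`. [cite: Saad1992, Ch. III §3.2 Thm 3.8–3.9] -/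
theorem formBound_of_re_mem_Icc {ι : Type*} [Fintype ι] {O : Matrix ι ι ℂ} {a b : ℝ} {x : ι → ℂ}
    (him : (star x ⬝ᵥ O *ᵥ x).im = 0) (ha : a * (star x ⬝ᵥ x).re ≤ (star x ⬝ᵥ O *ᵥ x).re)
    (hb : (star x ⬝ᵥ O *ᵥ x).re ≤ b * (star x ⬝ᵥ x).re) :
    ‖star x ⬝ᵥ O *ᵥ x - (((a + b) / 2 : ℝ) : ℂ) * (star x ⬝ᵥ x)‖ ≤ (b - a) / 2 * (star x ⬝ᵥ x).re := by
  have hn := Complex.nonneg_iff.1 (dotProduct_star_self_nonneg x)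
  have hnim : (star x ⬝ᵥ x).im = 0 := hn.2.symm
  have hz : star x ⬝ᵥ O *ᵥ x - (((a + b) / 2 : ℝ) : ℂ) * (star x ⬝ᵥ x) =
      (((star x ⬝ᵥ O *ᵥ x).re - (a + b) / 2 * (star x ⬝ᵥ x).re : ℝ) : ℂ) := by
    apply Complex.ext
    · simp [Complex.sub_re, Complex.mul_re, hnim]
    · simp [Complex.sub_im, Complex.mul_im, him, hnim]
  rw [hz, Complex.norm_real, Real.norm_eq_abs]
  exact abs_le.2 ⟨by linarith, by linarith⟩

/-- `⟨v, 𝐒_x·𝐒_y v⟩` is real (`𝐒_x·𝐒_y` is Hermitian). [cite: EsslerEtAl2005, §2.2.5] -/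
theorem im_expect_fermionSpinDot (x y : Λ) (v : Fock (Orb Λ)) :
    (star v ⬝ᵥ fermionSpinDot x y *ᵥ v).im = 0 := by
  have h := star_dotProduct_mulVec_comm (isHermitian_fermionSpinDot x y) v v
  exact Complex.conj_eq_iff_im.1 (by rw [← Complex.star_def]; exact h.symm)

end Generic

/-! ## §2 The range node on the torus: `(m, h) = ((L²+2)L²/4, (L²+2)L²/4)` -/

variable {L : ℕ}

/-- **Range node for `𝓢_A` (tree theorem)** on the even torus of side `L`:
`‖⟨x, 𝓢_A x⟩ − c⟨x, x⟩‖ ≤ c·Re⟨x, x⟩` with `c = (L²+2)L²/4`, from `0 ≤ 𝓢_A = 𝓢_s(π,π)` and the ceiling.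
[cite: Tasaki2020, App. A.3] [cite: HirschPRB1985, eq. (4.7)] -/
theorem stagSpinStructure_formBound [NeZero L] (hL : Even L) (x : Fock (Orb (FermionTorus 2 L))) :
    ‖star x ⬝ᵥ stagSpinStructure (evenSublattice L) *ᵥ x -
        ((((L : ℝ) ^ 2 + 2) * (L : ℝ) ^ 2 / 4 : ℝ) : ℂ) * (star x ⬝ᵥ x)‖ ≤
      ((L : ℝ) ^ 2 + 2) * (L : ℝ) ^ 2 / 4 * (star x ⬝ᵥ x).re := by
  have hcard : (Fintype.card (FermionTorus 2 L) : ℝ) = (L : ℝ) ^ 2 := by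
    rw [show Fintype.card (FermionTorus 2 L) = L ^ 2 by simp]
    push_cast
    ring
  have hL2 : (0 : ℝ) < (L : ℝ) ^ 2 := by have := NeZero.pos L; positivity
  have h0 : 0 ≤ (star x ⬝ᵥ stagSpinStructure (evenSublattice L) *ᵥ x).re := by
    have h := Observables.spinStructureFactor_nonneg L (piIndex L) x
    rw [Observables.spinStructureFactor, spinStructureOp_piIndex L hL] at h
    have h' := mul_nonneg h hL2.le
    rwa [div_mul_cancel₀ _ hL2.ne'] at h'
  have h1 := re_expect_stagSpinStructure_le_card (evenSublattice L) x
  rw [hcard] at h1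
  exact formBound_of_re_mem (im_expect_stagSpinStructure _ x) h0 (by linarith)

/-- **Range node for `𝓢_s(π,π)` (tree theorem)**: the same bound for m3-7's spin structure operator
at `(π,π)` (`= 𝓢_A` on an even torus). [cite: HirschPRB1985, eq. (4.7)] [cite: Tasaki2020, App. A.3] -/
theorem spinStructureOp_piIndex_formBound [NeZero L] (hL : Even L) (x : Fock (Orb (FermionTorus 2 L))) :
    ‖star x ⬝ᵥ Observables.spinStructureOp L (piIndex L) *ᵥ x -
        ((((L : ℝ) ^ 2 + 2) * (L : ℝ) ^ 2 / 4 : ℝ) : ℂ) * (star x ⬝ᵥ x)‖ ≤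
      ((L : ℝ) ^ 2 + 2) * (L : ℝ) ^ 2 / 4 * (star x ⬝ᵥ x).re := by
  rw [spinStructureOp_piIndex L hL]
  exact stagSpinStructure_formBound hL x

/-! ## §2b The `W_r` range node on the torus, `r ≠ 0`: `(m, h) = (−L²/4, L²/2)` -/

/-- `Σ_{x : torus} m_{ofTorusSite x} = Σ_{y : FermionTorus} m_y` (reindexing along `equivTorusSite`). -/
theorem sum_localMoment_ofTorusSite_eq [NeZero L] :
    ∑ x : TorusSite 2 L, (localMoment (FermionTorus.ofTorusSite x) :
        Matrix (Finset (Orb (FermionTorus 2 L))) (Finset (Orb (FermionTorus 2 L))) ℂ) =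
      ∑ y : FermionTorus 2 L, localMoment y :=
  Fintype.sum_equiv (FermionTorus.equivTorusSite).symm _ _ fun _ => rfl

/-- `0 ≤ Re⟨ψ, Σ_x m_x ψ⟩ ≤ L²·Re⟨ψ, ψ⟩` on the torus (§1 with `|Λ| = L²`). [cite: Tasaki2020, App. A.3] -/
theorem re_expect_sum_localMoment_torus_mem [NeZero L] (ψ : Fock (Orb (FermionTorus 2 L))) :
    0 ≤ (star ψ ⬝ᵥ (∑ x : TorusSite 2 L, (localMoment (FermionTorus.ofTorusSite x) :
        Matrix (Finset (Orb (FermionTorus 2 L))) (Finset (Orb (FermionTorus 2 L))) ℂ)) *ᵥ ψ).re ∧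
      (star ψ ⬝ᵥ (∑ x : TorusSite 2 L, (localMoment (FermionTorus.ofTorusSite x) :
        Matrix (Finset (Orb (FermionTorus 2 L))) (Finset (Orb (FermionTorus 2 L))) ℂ)) *ᵥ ψ).re ≤
        (L : ℝ) ^ 2 * (star ψ ⬝ᵥ ψ).re := by
  have hcard : (Fintype.card (FermionTorus 2 L) : ℝ) = (L : ℝ) ^ 2 := by
    rw [show Fintype.card (FermionTorus 2 L) = L ^ 2 by simp]
    push_cast
    ring
  rw [sum_localMoment_ofTorusSite_eq]
  refine ⟨(Complex.nonneg_iff.1 ((posSemidef_sum_localMoment Finset.univ).dotProduct_mulVec_nonneg ψ)).1, ?_⟩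
  have h := re_expect_sum_localMoment_le (Λ := FermionTorus 2 L) ψ
  rwa [hcard] at h

/-- `⟨ψ, W_r ψ⟩` is real. [cite: EsslerEtAl2005, §2.2.5] -/
theorem im_expect_spinCorrSum [NeZero L] (r : TorusSite 2 L) (ψ : Fock (Orb (FermionTorus 2 L))) :
    (star ψ ⬝ᵥ Observables.spinCorrSum L r *ᵥ ψ).im = 0 := by
  unfold Observables.spinCorrSum
  rw [Matrix.sum_mulVec, dotProduct_sum, Complex.im_sum]
  exact Finset.sum_eq_zero fun u _ => im_expect_fermionSpinDot _ _ ψ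

/-- **Range node for `W_r`, `r ≠ 0` (tree theorem)**: `‖⟨x, W_r x⟩ + (L²/4)⟨x, x⟩‖ ≤ (L²/2)·Re⟨x, x⟩`,
i.e. `(m, h) = (−L²/4, L²/2)`, from m3-7's sandwich `−¾ Σ m_x ≤ W_r ≤ ¼ Σ m_x`
(`Observables.neg_re_expect_sum_localMoment_le_spinCorrSum`,
`Observables.re_expect_spinCorrSum_le_quarter_sum_localMoment`) and `0 ≤ Σ m_x ≤ L²`.
[cite: EsslerEtAl2005, §2.2.5] [cite: Tasaki2020, App. A.3] -/
theorem spinCorrSum_formBound [NeZero L] {r : TorusSite 2 L} (hr : r ≠ 0)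
    (x : Fock (Orb (FermionTorus 2 L))) :
    ‖star x ⬝ᵥ Observables.spinCorrSum L r *ᵥ x - ((-((L : ℝ) ^ 2) / 4 : ℝ) : ℂ) * (star x ⬝ᵥ x)‖ ≤
      (L : ℝ) ^ 2 / 2 * (star x ⬝ᵥ x).re := by
  have hm := re_expect_sum_localMoment_torus_mem x
  have h1 := Observables.neg_re_expect_sum_localMoment_le_spinCorrSum L hr x
  have h2 := Observables.re_expect_spinCorrSum_le_quarter_sum_localMoment L hr x
  simp only [expect] at h1 h2
  have key := formBound_of_re_mem_Icc (a := -(3 / 4) * (L : ℝ) ^ 2) (b := 1 / 4 * (L : ℝ) ^ 2)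
    (im_expect_spinCorrSum r x) (by nlinarith [hm.1, hm.2]) (by nlinarith [hm.1, hm.2])
  have e1 : (-(3 / 4) * (L : ℝ) ^ 2 + 1 / 4 * (L : ℝ) ^ 2) / 2 = -((L : ℝ) ^ 2) / 4 := by ring
  have e2 : (1 / 4 * (L : ℝ) ^ 2 - -(3 / 4) * (L : ℝ) ^ 2) / 2 = (L : ℝ) ^ 2 / 2 := by ring
  rw [e1, e2] at key
  exact key

/-- `e₁ ≠ 0` on the torus of even side `L` (`L ≠ 1`). -/
theorem piSingle_ne_zero [NeZero L] (hL : Even L) : (Pi.single 0 1 : TorusSite 2 L) ≠ 0 := by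
  intro h
  have h1 : (1 : ZMod L) = 0 := by simpa using congrFun h 0
  rw [ZMod.one_eq_zero_iff] at h1
  subst h1
  exact absurd hL (by decide)

/-! ## §3 The `S(π,π)`, `m_s²` and `C₁` enclosure edges of part 8 without the range hypothesis -/

section Rows

variable [NeZero L] (hL : Even L) {U : ℝ} (hU : 0 < U)
  {K : Submodule ℂ (Fock (Orb (FermionTorus 2 L)))} (hKN : K ≤ nParticleSubmodule (L ^ 2))
  (hKH : ∀ v ∈ K, hamiltonian (fermionTorusGraph 2 L) 1 U *ᵥ v ∈ K) (hpin : TorusBlockPinRow L U K)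
  {W : Submodule ℂ (Fock (Orb (FermionTorus 2 L)))} {u : Fock (Orb (FermionTorus 2 L))} {σ : ℝ}
  (hW : ∀ z ∈ W, σ * (star z ⬝ᵥ z).re ≤ (star z ⬝ᵥ hamiltonian (fermionTorusGraph 2 L) 1 U *ᵥ z).re)
  (hWK : ∀ x ∈ K, ∃ z ∈ W, ∃ c : ℂ, x = z + c • u)
  {w : Fock (Orb (FermionTorus 2 L))} (hwK : w ∈ K) {N ρ r2 : ℝ} (hN : 0 < N)
  (hwN : (star w ⬝ᵥ w).re = N)
  (hρ : (star w ⬝ᵥ hamiltonian (fermionTorusGraph 2 L) 1 U *ᵥ w).re = ρ * N)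
  (hr2 : (star (hamiltonian (fermionTorusGraph 2 L) 1 U *ᵥ w) ⬝ᵥ
    hamiltonian (fermionTorusGraph 2 L) 1 U *ᵥ w).re ≤ (r2 + ρ ^ 2) * N)
  (hρσ : ρ < σ) {β o : ℝ} (hβ : 0 ≤ β) (hβr : r2 ≤ β ^ 2 * (σ - ρ) ^ 2)
include hL hU hKN hKH hpin hW hWK hwK hN hwN hρ hr2 hρσ hβ hβr

/-- **`T{L}_S` from a pinned-block certificate, range node discharged**
(`spinStructureOp_piIndex_formBound`): mixing radius `((L²+2)L²/2)(β + β²)` around the exact trial value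
`o = Re⟨w, 𝓢_s(π,π) w⟩/N`. [cite: Hirsch1985, §III] [cite: Saad1992, Ch. III §3.2 Thm 3.8–3.9] -/
theorem TorusStagSFRow.of_blockPin_templeKato_range
    (ho : (star w ⬝ᵥ Observables.spinStructureOp L (piIndex L) *ᵥ w).re = o * N)
    {lo hi : ℚ} (hlo : ((lo : ℚ) : ℝ) * (L : ℝ) ^ 2 ≤ o - ((L : ℝ) ^ 2 + 2) * (L : ℝ) ^ 2 / 2 * (β + β ^ 2))
    (hhi : o + ((L : ℝ) ^ 2 + 2) * (L : ℝ) ^ 2 / 2 * (β + β ^ 2) ≤ ((hi : ℚ) : ℝ) * (L : ℝ) ^ 2) :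
    TorusStagSFRow L U lo hi :=
  TorusStagSFRow.of_blockPin_templeKato hL hU hKN hKH hpin hW hWK hwK hN hwN hρ hr2 hρσ hβ hβr
    (spinStructureOp_piIndex_formBound hL) ho
    (by have : 2 * (((L : ℝ) ^ 2 + 2) * (L : ℝ) ^ 2 / 4) * (β + β ^ 2) =
          ((L : ℝ) ^ 2 + 2) * (L : ℝ) ^ 2 / 2 * (β + β ^ 2) := by ring
        linarith)
    (by have : 2 * (((L : ℝ) ^ 2 + 2) * (L : ℝ) ^ 2 / 4) * (β + β ^ 2) =
          ((L : ℝ) ^ 2 + 2) * (L : ℝ) ^ 2 / 2 * (β + β ^ 2) := by ring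
        linarith)

/-- **`T{L}_ms2` from a pinned-block certificate, range node discharged**
(`stagSpinStructure_formBound`): mixing radius `((L²+2)L²/2)(β + β²)` around `o = Re⟨w, 𝓢_A w⟩/N`,
row scale `L⁴`. [cite: LiebPRL1989, Theorem 2] [cite: Saad1992, Ch. III §3.2 Thm 3.8–3.9] -/
theorem StagMagSqRow.of_blockPin_templeKato_range
    (ho : (star w ⬝ᵥ stagSpinStructure (evenSublattice L) *ᵥ w).re = o * N)
    {lo hi : ℚ} (hlo : ((lo : ℚ) : ℝ) * (L : ℝ) ^ 4 ≤ o - ((L : ℝ) ^ 2 + 2) * (L : ℝ) ^ 2 / 2 * (β + β ^ 2))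
    (hhi : o + ((L : ℝ) ^ 2 + 2) * (L : ℝ) ^ 2 / 2 * (β + β ^ 2) ≤ ((hi : ℚ) : ℝ) * (L : ℝ) ^ 4) :
    StagMagSqRow L U lo hi :=
  StagMagSqRow.of_blockPin_templeKato hL hU hKN hKH hpin hW hWK hwK hN hwN hρ hr2 hρσ hβ hβr
    (stagSpinStructure_formBound hL) ho
    (by have : 2 * (((L : ℝ) ^ 2 + 2) * (L : ℝ) ^ 2 / 4) * (β + β ^ 2) =
          ((L : ℝ) ^ 2 + 2) * (L : ℝ) ^ 2 / 2 * (β + β ^ 2) := by ring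
        linarith)
    (by have : 2 * (((L : ℝ) ^ 2 + 2) * (L : ℝ) ^ 2 / 4) * (β + β ^ 2) =
          ((L : ℝ) ^ 2 + 2) * (L : ℝ) ^ 2 / 2 * (β + β ^ 2) := by ring
        linarith)

/-- **`T{L}_C1` from a pinned-block certificate, range node discharged** (`spinCorrSum_formBound` at
`r = e₁`): mixing radius `L²(β + β²)` around the exact trial value `o = Re⟨w, W_{e₁} w⟩/N`.
[cite: EsslerEtAl2005, §2.2.5] [cite: Saad1992, Ch. III §3.2 Thm 3.8–3.9] -/
theorem TorusSpinNNRow.of_blockPin_templeKato_range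
    (ho : (star w ⬝ᵥ Observables.spinCorrSum L (Pi.single 0 1) *ᵥ w).re = o * N)
    {lo hi : ℚ} (hlo : ((lo : ℚ) : ℝ) * (L : ℝ) ^ 2 ≤ o - (L : ℝ) ^ 2 * (β + β ^ 2))
    (hhi : o + (L : ℝ) ^ 2 * (β + β ^ 2) ≤ ((hi : ℚ) : ℝ) * (L : ℝ) ^ 2) :
    TorusSpinNNRow L U lo hi :=
  TorusSpinNNRow.of_blockPin_templeKato hL hU hKN hKH hpin hW hWK hwK hN hwN hρ hr2 hρσ hβ hβr
    (spinCorrSum_formBound (piSingle_ne_zero hL)) ho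
    (by have : 2 * ((L : ℝ) ^ 2 / 2) * (β + β ^ 2) = (L : ℝ) ^ 2 * (β + β ^ 2) := by ring
        linarith)
    (by have : 2 * ((L : ℝ) ^ 2 / 2) * (β + β ^ 2) = (L : ℝ) ^ 2 * (β + β ^ 2) := by ring
        linarith)

end Rows

end M2
end Summit.Ventures.CertifiedManyBodySolver
end
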